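/-
Copyright (c) 2026 the pub-hodgecm-mathlib formalisation cell (harness21).  Prover seat hodgecm-mathlib-K2Liu-p24 (g0), Track B «K2-LIT» ∕ hLiu418
#184♮, socket #42S assembler (K2Liu-p03 (g7) `K2LiuStandardSectionSpanAssembly`) and #42F′ ∕ #42R seam: the DET-TWIST DATUM OF RECORD «`∃ α, α̃ = λ̃²`»
(letter (ℓ1); LEAD F0P6-plan (g14) BATCH #50 (1), K2E5-plan (g7) TABLE #6).  THEOREMS ONLY.
-/
import Literature.NumberTheory.Automorphic.UnitaryGroupAdelicOneTorusDictionary         -- ★ `UnitaryGroup.exists_adelicOneChar_eq`: the idelic Hilbert-90 dictionary in the `U(1)` currency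
import Literature.NumberTheory.GelbartRogawski1991.DoubledWeilRepresentationDetTwist   -- ★ `DoubledWeilDetTwist.ratioHecke`, `idelesRatio`, `conjIdele_eq_smul`
import Literature.RepresentationTheory.Liu2021.OscillatorConventions                    -- ★ `isOscillatorChar_toHeckeCharacter_iff` (= HKS96 (1.5) at `m = 1`)
import Literature.NumberTheory.Automorphic.Liu2021.CheckOfChiConjugateOrthogonal        -- ★ `toHeckeCharacter_inv`
import Summits.HodgeConjecture.HodgeConjecture.Theorems.K2LiuConjugateSymplecticInv     -- ★ `IsConjugateSymplectic.inv`
import HarnessLib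

/-!
# K2_Liu road (hLiu418 = stmt-HodgeConjecture-24832): THE DET-TWIST DATUM OF RECORD — for a conjugate-symplectic `λ` there ARE a unitary splitting
# character `χ_b` and an automorphic character `α` of `U(1)(𝔸_{L⁺})` with `χ_b³ · α̃ = λ̃⁻¹` (`χ_b := λ̃⁻¹`, `α̃ = λ̃²`)

Cell `pub/hodgecm-mathlib` (D-0151), Track B, build stream 29; helper lane, count-neutral.  Every #42 organ of the hLiu418 line (socket #42F′ :711, #42S :866, the
seam ★ p858375, ★ 0a∕0b∕0c, K2Liu-p03 (g7)'s #42S assembler `K2LiuStandardSectionSpanAssembly`) carries the DET-TWIST binders of ★ O42.3f∕O42.3g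

  `(χb : HeckeCharacter L) (hχbu : χb.IsUnitary) (hχbs : IsSplittingChar L 1 χb) (α : U(1)(𝔸_{L⁺}) →* ℂˣ) (hα : Continuous α)`
  `(hαrat : ∀ u, (u : 𝕀_L) ∈ Lˣ → α u = 1) (_hχD : χb ^ 3 * DoubledWeilDetTwist.ratioHecke L α hα hαrat = toHeckeCharacter L lam⁻¹)`

(the twisted Siegel–Weil generator is a section of `I(s, χ_D)`, `χ_D = λ̃⁻¹`, iff `χ_b³ · α̃ = λ̃⁻¹`, `α̃(d) = α(d ∕ d̄)` the Hecke character ★ `ratioHecke` of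
[GelbartRogawski1991, §3.1 Remark p. 457]).  The caller of the line (tier-0 `stub_firstTermThetaPairing`) must DISCHARGE them; K2Liu-p03 (g7) 2026-09-04T15:25:40Z:
«the caller's `χb := λ̃⁻¹, α̃ := λ̃²`; whoever owns `∃ α, α̃ = λ̃²` says its ★ name — else it stays a binder of the tie».  THIS FILE discharges them, from ★
capital only:

* §1 **`exists_ratioHecke_eq`** — THE DICTIONARY IN THE LINE'S CURRENCY: every Hecke character `χ` of `L` trivial on the base-changed ideles `(𝕀_{L⁺})_L` is
  `α̃ = ratioHecke L α hα hαrat` for a continuous automorphic `α : U(1)(𝔸_{L⁺}) →* ℂˣ` (★ `UnitaryGroup.adelicOne`).  This is ★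
  `UnitaryGroup.exists_adelicOneChar_eq` (= ★ `Arthur2013.Leaves.TECR.TorusDict.exists_pullback_eq` — idelic Hilbert 90 `𝕀_L ↠ T(𝔸)`, `z ↦ z̄ ∕ z`, an OPEN
  surjection; field Hilbert 90 on principal ideles; [CasselsFrohlichANT1967, Ch. VII §7.4 Cor. (a)] — read in the `U(1)` currency, ★
  `UnitaryGroupAdelicOneTorusDictionary`) composed with the inversion `d ∕ d̄ = (d̄ ∕ d)⁻¹` (`α u := α₀(u⁻¹)`).
* §2 **`exists_ratioHecke_eq_inv_sq_of_isSplittingChar`** — for a splitting character `μ` (`μ|_{𝕀_{L⁺}} = ε`, [HarrisKudlaSweet1996, (1.5)]), `μ⁻²` is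
  trivial on `(𝕀_{L⁺})_L` (`ε² = 1`, ★ `quadraticHeckeCharCM_apply_sq`), hence `= α̃`; **`exists_detTwistDatum_of_isConjugateSymplectic`** — THE DATUM OF
  RECORD: for `λ` conjugate symplectic, `χ_b := toHeckeCharacter L lam⁻¹` (unitary ★ `isUnitary_toHeckeCharacter`, splitting by ★
  `isOscillatorChar_toHeckeCharacter_iff` + ★ `IsConjugateSymplectic.inv`) and `α̃ := χ_b⁻²` satisfy `χ_b³ · α̃ = λ̃⁻¹` — the seven binders, by `obtain`;
  `exists_ratioHecke_eq_toHeckeCharacter_sq` — the same `α` has `α̃ = (toHeckeCharacter L lam)²` («`∃ α, α̃ = λ̃²`» verbatim, ★ `toHeckeCharacter_inv`).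

No definition, no instance, no notation, no named-fact hypothesis, no `sorry`; axioms ⊆ {propext, Classical.choice, Quot.sound}.  HONEST LABEL: HC_CM is
proved only modulo the 7 printed citations (2 remaining named inputs: hLiu418 = stmt-HodgeConjecture-24832, h413 = stmt-HodgeConjecture-24833) until rung 0
closes; this file is a `--supports stmt-HodgeConjecture-24832` helper and moves no counter.

References: [GelbartRogawski1991] S. Gelbart, J. Rogawski, Invent. Math. 105 (1991) §3.1 Remark p. 457 L4–13 («a choice of `s` is equivalent to a choice
of Hecke character of `E`»); [HarrisKudlaSweet1996] J. AMS 9 (1996) §1 (1.5), (1.14)–(1.15); [CasselsFrohlichANT1967] Ch. VII (Tate) §7.4 Cor. (a)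
(`H¹(G, J_L) = 0`); [Liu2021] Y. Liu, Camb. J. Math. 9 (2021) Def. 4.1, App. D §D.1 Step 2; [Kudla1994] Israel J. Math. 87 (1994) §3.
-/

set_option autoImplicit false
set_option linter.dupNamespace false

noncomputable section

open NumberField IsDedekindDomain
open Literature.NumberTheory.Automorphic Literature.NumberTheory.Automorphic.IdeleClassGroup
open Literature.NumberTheory.GaloisRepresentations
open Literature.NumberTheory.GelbartRogawski1991 Literature.NumberTheory.GelbartRogawski1991.GRConstruction
open Literature.NumberTheory.GelbartRogawski1991.GRConstruction.DoubledWeilDetTwist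
open Literature.RepresentationTheory.HarrisKudlaSweet1996 Literature.RepresentationTheory.Liu2021

namespace Summit.HodgeConjecture.HodgeConjecture.Cruxes.HLiu418.K2LiuSWGeneratorCharacterOfRecord

variable (L : Type) [Field L] [NumberField L] [IsCMField L]

/-! ## §1 The Hilbert-90 dictionary in the line's currency: `χ` trivial on `(𝕀_{L⁺})_L` ⇒ `χ = α̃` -/

/-- **THE DICTIONARY `χ = α̃`**: a Hecke character `χ` of the CM field `L` that is trivial on the base-changed ideles of `L⁺` is `ratioHecke L α hα hαrat`
(`d ↦ α(d ∕ d̄)`) for a continuous character `α` of `U(1)(𝔸_{L⁺})` trivial on the principal norm-one ideles — ★ `UnitaryGroup.exists_adelicOneChar_eq` (★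
`TorusDict.exists_pullback_eq`: idelic and field Hilbert 90, open-mapping continuity; convention `z ↦ α₀(z̄ ∕ z)`) composed with inversion on the commutative
group `U(1)(𝔸_{L⁺})`: `α u := α₀ u⁻¹`, since `d ∕ d̄ = (d̄ ∕ d)⁻¹`.
[cite: CasselsFrohlichANT1967, Ch. VII (Tate) §7.4 Cor. (a)] [cite: GelbartRogawski1991, §3.1 Remark p. 457 L4–13] [cite: HarrisKudlaSweet1996, §1 (1.15)] -/
theorem exists_ratioHecke_eq (χ : HeckeCharacter L) (hχ : ∀ a : ideleGroup (Fp L), χ (AdeleRing.ideleBaseChange (Fp L) L a) = 1) :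
    ∃ (α : UnitaryGroup.adelicOne (Fp L) L (IsCMField.complexConj L) →* ℂˣ) (hα : Continuous α)
      (hαrat : ∀ u : UnitaryGroup.adelicOne (Fp L) L (IsCMField.complexConj L), (u : ideleGroup L) ∈ principalIdeles L → α u = 1),
      ratioHecke L α hα hαrat = χ := by
  obtain ⟨α₀, hα₀, hα₀rat, hχα⟩ := UnitaryGroup.exists_adelicOneChar_eq (Fp L) L (IsCMField.complexConj L)
    (Algebra.IsQuadraticExtension.finrank_eq_two (Fp L) L) (IsCMField.complexConj_ne_one (K := L)) χ hχ
  refine ⟨α₀.comp invMonoidHom, hα₀.comp continuous_inv, fun u hu => ?_, ?_⟩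
  · -- automorphy: `u⁻¹` is a principal norm-one idele
    exact hα₀rat u⁻¹ (by rw [Subgroup.coe_inv]; exact inv_mem hu)
  · -- `α₀ ((d ∕ d̄)⁻¹) = α₀ (d̄ ∕ d)`: the two norm-one ideles agree definitionally (`conjIdele d = c • d`, inversion in `𝕀_L`)
    ext d
    rw [ratioHecke_apply, MonoidHom.comp_apply, invMonoidHom_apply, hχα d]
    exact congrArg (fun u => ((α₀ u : ℂˣ) : ℂ))
      (Subtype.ext (by rw [Subgroup.coe_inv, coe_idelesRatio, conjIdele_eq_smul, inv_div]))

/-! ## §2 The datum of record for a conjugate-symplectic `λ`: `χ_b := λ̃⁻¹`, `α̃ = λ̃²` -/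

/-- A SPLITTING character (`μ|_{𝕀_{L⁺}} = ε_{L∕L⁺}`, [HarrisKudlaSweet1996, (1.5)] at `m = 1`) has `μ⁻²` trivial on `(𝕀_{L⁺})_L` (`ε² = 1`), so `μ⁻² = α̃` for an
automorphic `α`. [cite: HarrisKudlaSweet1996, §1 (1.5), (1.15)] [cite: GelbartRogawski1991, §3.1 Remark p. 457 L4–13] -/
theorem exists_ratioHecke_eq_inv_sq_of_isSplittingChar (μ : HeckeCharacter L) (hμ : IsSplittingChar L 1 μ) :
    ∃ (α : UnitaryGroup.adelicOne (Fp L) L (IsCMField.complexConj L) →* ℂˣ) (hα : Continuous α)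
      (hαrat : ∀ u : UnitaryGroup.adelicOne (Fp L) L (IsCMField.complexConj L), (u : ideleGroup L) ∈ principalIdeles L → α u = 1),
      ratioHecke L α hα hαrat = (μ ^ 2)⁻¹ :=
  exists_ratioHecke_eq L _ fun a => by
    rw [HeckeCharacter.inv_apply, HeckeCharacter.pow_apply, hμ a, pow_one, quadraticHeckeCharCM_apply_sq, inv_one]

/-- **THE DET-TWIST DATUM OF RECORD.**  For a conjugate-symplectic `λ` the seven det-twist binders of the #42 organs are INHABITED: `χ_b := toHeckeCharacter L lam⁻¹`
(unitary; splitting because `λ⁻¹` is conjugate symplectic), `α` automorphic continuous with `α̃ = χ_b⁻²`, and then `χ_b ^ 3 * α̃ = χ_b = toHeckeCharacter L lam⁻¹`.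
Consumers `obtain ⟨χb, hχbu, hχbs, α, hα, hαrat, hχD⟩ := …` and feed #42S ∕ #42F′ ∕ the seam. [cite: GelbartRogawski1991, §3.1 Remark p. 457 L4–13]
[cite: HarrisKudlaSweet1996, §1 (1.5), (1.14)–(1.15)] [cite: Liu2021, Def. 4.1, App. D §D.1 Step 2] -/
theorem exists_detTwistDatum_of_isConjugateSymplectic (lam : Literature.NumberTheory.Automorphic.IdeleClassGroup L →ₜ* Circle)
    (hlam : IsConjugateSymplectic L lam) :
    ∃ (χb : HeckeCharacter L) (_hχbu : χb.IsUnitary) (_hχbs : IsSplittingChar L 1 χb)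
      (α : UnitaryGroup.adelicOne (Fp L) L (IsCMField.complexConj L) →* ℂˣ) (hα : Continuous α)
      (hαrat : ∀ u : UnitaryGroup.adelicOne (Fp L) L (IsCMField.complexConj L), (u : ideleGroup L) ∈ principalIdeles L → α u = 1),
      χb ^ 3 * ratioHecke L α hα hαrat = toHeckeCharacter L lam⁻¹ := by
  have hspl : IsSplittingChar L 1 (toHeckeCharacter L lam⁻¹) :=
    (isOscillatorChar_toHeckeCharacter_iff lam⁻¹).mpr (K2LiuConjugateSymplecticInv.IsConjugateSymplectic.inv hlam)
  obtain ⟨α, hα, hαrat, hαeq⟩ := exists_ratioHecke_eq_inv_sq_of_isSplittingChar L (toHeckeCharacter L lam⁻¹) hspl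
  refine ⟨toHeckeCharacter L lam⁻¹, isUnitary_toHeckeCharacter L lam⁻¹, hspl, α, hα, hαrat, ?_⟩
  rw [hαeq]
  group

/-- **«`∃ α, α̃ = λ̃²`» VERBATIM**: for a conjugate-symplectic `λ` there is an automorphic continuous `α` on `U(1)(𝔸_{L⁺})` with
`ratioHecke L α hα hαrat = (toHeckeCharacter L lam) ^ 2` (`λ̃²|_{𝕀_{L⁺}} = ε² = 1`). [cite: GelbartRogawski1991, §3.1 Remark p. 457 L4–13]
[cite: HarrisKudlaSweet1996, §1 (1.5), (1.15)] [cite: CasselsFrohlichANT1967, Ch. VII (Tate) §7.4 Cor. (a)] -/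
theorem exists_ratioHecke_eq_toHeckeCharacter_sq (lam : Literature.NumberTheory.Automorphic.IdeleClassGroup L →ₜ* Circle)
    (hlam : IsConjugateSymplectic L lam) :
    ∃ (α : UnitaryGroup.adelicOne (Fp L) L (IsCMField.complexConj L) →* ℂˣ) (hα : Continuous α)
      (hαrat : ∀ u : UnitaryGroup.adelicOne (Fp L) L (IsCMField.complexConj L), (u : ideleGroup L) ∈ principalIdeles L → α u = 1),
      ratioHecke L α hα hαrat = toHeckeCharacter L lam ^ 2 := by
  have hspl : IsSplittingChar L 1 (toHeckeCharacter L lam⁻¹) :=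
    (isOscillatorChar_toHeckeCharacter_iff lam⁻¹).mpr (K2LiuConjugateSymplecticInv.IsConjugateSymplectic.inv hlam)
  obtain ⟨α, hα, hαrat, hαeq⟩ := exists_ratioHecke_eq_inv_sq_of_isSplittingChar L (toHeckeCharacter L lam⁻¹) hspl
  refine ⟨α, hα, hαrat, ?_⟩
  rw [hαeq, toHeckeCharacter_inv, inv_pow, inv_inv]

end Summit.HodgeConjecture.HodgeConjecture.Cruxes.HLiu418.K2LiuSWGeneratorCharacterOfRecord

end
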